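import Summits.NavierStokesRegularity.NavierStokesRegularity.Theorems.FilamentSkeletonRssKelvinGateNeumann

/-!
# Route `FilamentSkeletonRss` · crux `TransverseReductionRJ` (stmt-NavierStokesRegularity-21221) — line `kelvin_gate`,
# stub S2 `PolynomialKelvinGate`: the CORE of a Kelvin gate is STABLE under X-small perturbations of the base family

Helper file (theorems only, `--supports stmt-NavierStokesRegularity-21221 --as helper`), in the vocabulary of
`FilamentSkeletonRssKelvinGateDefs` / `…Tools` / `…Bilinear` / `…Neumann`.  HONEST FRAMING: bookkeeping for a
HYPOTHETICAL filament-type RSS blow-up route; nothing here bears on Navier–Stokes regularity; no stub is proved here.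

THE LEMMA.  Let `(𝓚, 𝓠, 𝓑)` satisfy `GateSpec N Γ κ C₂ α D U⁰` (a right inverse of `𝓛_(α_p,U⁰_p) + ∇` modulo the
accretion modes, Y-scale → X-scale, norm `A = C₂ Γ^κ`), and let `V_p` be a perturbation of the base family which is
X-bounded by `ν` with `8 A ν ≤ 1`.  Since `𝓛_(α,U⁰+V) W = 𝓛_(α,U⁰) W + DW[V] + DV[W]` (`lerayLin_add_base`) and the
operator `T_p G := D(𝓚_p G)[V_p] + DV_p[𝓚_p G]` contracts the Y-scale by `θ = 4 A ν ≤ ½` (`…Bilinear`), the Neumann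
solution operator `S_p` of `G = F − T_p G` (`…Neumann`) conjugates the gate:
`𝓚'_p := 𝓚_p ∘ S_p`, `𝓠'_p := 𝓠_p ∘ S_p`, `𝓑'_p := 𝓑_p ∘ S_p` solve
`𝓛_(α_p, U⁰_p + V_p) (𝓚'_p F) + ∇(𝓠'_p F) = F + Σ_j (𝓑'_p F)_j D_pj`, `div 𝓚'_p F = 0`, with all bounds multiplied by `2`,
and are linear on Y-bounded data — i.e. clauses (1) and (2) of `GateSpec` for the base `U⁰ + V` with constant `2 C₂`
(`GateSpec.perturb_core`).  Clauses (3) (tightness) and (4) (continuity in `p`) are deliberately NOT treated: they are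
under reshape review (director-ns dss_23, typer g30's «S3-SIZING» note, J-clause), and (3) is not stable under this
conjugation without a ladder of radii anyway.

WHY IT MATTERS FOR S2 (recorded, not claimed).  Two base families of the SAME box which are X-close within `1/(8 C₂ Γ^κ)`
share their gates up to a factor `2`; in particular all order-`k` bases in the perturbative branch of a gated base
(`X`-distance `O(C₂ Cr Γ^{κ−k})`, `k > 2κ`) are gated uniformly — the mechanism behind the planner-facing remark in
`…KelvinGateOrderOne`.  Bases in OTHER branches (X-far near-solutions with the same window data) are not reached.
-/

set_option linter.dupNamespace false

noncomputable section

namespace Summit.NavierStokesRegularity.NavierStokesRegularity.Theorems.KelvinGate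

open Set Function Filter
open Literature.Analysis.FluidPDE
open scoped InnerProductSpace Laplacian ContDiff Topology

/-! ## The linearised operator under a change of base -/

/-- **Change of base in the linearisation.**  `𝓛_(α, U⁰ + V) W (y) = 𝓛_(α, U⁰) W (y) + (DW(y)[V(y)] + DV(y)[W(y)])`
wherever `U⁰` and `V` are differentiable (the base enters `lerayLin` only through `DW[U⁰] + DU⁰[W]`). -/
theorem lerayLin_add_base (α : ℝ) (U0 V W : EuclideanSpace ℝ (Fin 3) → EuclideanSpace ℝ (Fin 3))
    (y : EuclideanSpace ℝ (Fin 3)) (hU : DifferentiableAt ℝ U0 y) (hV : DifferentiableAt ℝ V y) :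
    lerayLin α (fun z => U0 z + V z) W y = lerayLin α U0 W y + (fderiv ℝ W y (V y) + fderiv ℝ V y (W y)) := by
  unfold lerayLin
  rw [fderiv_fun_add hU hV]
  have e : (fderiv ℝ U0 y + fderiv ℝ V y) (W y) = fderiv ℝ U0 y (W y) + fderiv ℝ V y (W y) := rfl
  rw [e, map_add]
  abel

/-! ## Conjugating a gate by the Neumann series of `T_p G = D(𝓚_p G)[V_p] + DV_p[𝓚_p G]` -/

/-- **The core of a Kelvin gate is stable under X-small perturbations of the base family.**  If `(𝓚, 𝓠, 𝓑)`
satisfies `GateSpec N Γ κ C₂ α D U⁰`, the base fields `U⁰_p` are differentiable, and `V_p` is X-bounded by `ν` with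
`8 · C₂ Γ^κ · ν ≤ 1` at every `p` of the cube, then there are operators `(𝓚', 𝓠', 𝓑')` satisfying, at every `p` of
the cube, clause (1) of `GateSpec` for the base `U⁰ + V` with constant `2 C₂` — X-bound, `C¹` pressure, pressure and
multiplier bounds `≤ 2 C₂ Γ^κ · R`, divergence-free, and the equation
`𝓛_(α_p, U⁰_p + V_p)(𝓚'_p F) + ∇(𝓠'_p F) = F + Σ_j (𝓑'_p F)_j D_pj` — and clause (2), linearity of `𝓚'_p, 𝓑'_p` on
Y-bounded data.  (Construction: `𝓚'_p = 𝓚_p ∘ S_p` etc., `S_p` the Neumann solution operator of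
`G = F − (D(𝓚_p G)[V_p] + DV_p[𝓚_p G])`, contraction factor `4 C₂ Γ^κ ν ≤ ½`.) -/
theorem GateSpec.perturb_core {N : ℕ} {Γ κ C₂ : ℝ} {α : (Fin N → ℝ) → ℝ}
    {D : (Fin N → ℝ) → Fin N → EuclideanSpace ℝ (Fin 3) → EuclideanSpace ℝ (Fin 3)}
    {U0 : (Fin N → ℝ) → EuclideanSpace ℝ (Fin 3) → EuclideanSpace ℝ (Fin 3)}
    {𝓚 : (Fin N → ℝ) → (EuclideanSpace ℝ (Fin 3) → EuclideanSpace ℝ (Fin 3)) → EuclideanSpace ℝ (Fin 3) → EuclideanSpace ℝ (Fin 3)}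
    {𝓠 : (Fin N → ℝ) → (EuclideanSpace ℝ (Fin 3) → EuclideanSpace ℝ (Fin 3)) → EuclideanSpace ℝ (Fin 3) → ℝ}
    {𝓑 : (Fin N → ℝ) → (EuclideanSpace ℝ (Fin 3) → EuclideanSpace ℝ (Fin 3)) → Fin N → ℝ}
    (hgate : GateSpec N Γ κ C₂ α D U0 𝓚 𝓠 𝓑)
    (hU0 : ∀ p : Fin N → ℝ, (∀ i, p i ∈ Icc (0:ℝ) 1) → Differentiable ℝ (U0 p))
    {V : (Fin N → ℝ) → EuclideanSpace ℝ (Fin 3) → EuclideanSpace ℝ (Fin 3)} {ν : ℝ}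
    (hV : ∀ p : Fin N → ℝ, (∀ i, p i ∈ Icc (0:ℝ) 1) → XBound (V p) ν) (hν : 8 * (C₂ * Γ ^ κ) * ν ≤ 1) :
    ∃ (𝓚' : (Fin N → ℝ) → (EuclideanSpace ℝ (Fin 3) → EuclideanSpace ℝ (Fin 3)) → EuclideanSpace ℝ (Fin 3) → EuclideanSpace ℝ (Fin 3))
      (𝓠' : (Fin N → ℝ) → (EuclideanSpace ℝ (Fin 3) → EuclideanSpace ℝ (Fin 3)) → EuclideanSpace ℝ (Fin 3) → ℝ)
      (𝓑' : (Fin N → ℝ) → (EuclideanSpace ℝ (Fin 3) → EuclideanSpace ℝ (Fin 3)) → Fin N → ℝ),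
      ∀ p : Fin N → ℝ, (∀ i, p i ∈ Icc (0:ℝ) 1) →
        (∀ (F : EuclideanSpace ℝ (Fin 3) → EuclideanSpace ℝ (Fin 3)) (R : ℝ), YBound F R →
            XBound (𝓚' p F) (2 * C₂ * Γ ^ κ * R) ∧ ContDiff ℝ 1 (𝓠' p F) ∧ (∀ y, |𝓠' p F y| ≤ 2 * C₂ * Γ ^ κ * R) ∧
            (∀ j, |𝓑' p F j| ≤ 2 * C₂ * Γ ^ κ * R) ∧ VectorCalculus.IsDivFree (𝓚' p F) ∧
            ∀ y, lerayLin (α p) (fun z => U0 p z + V p z) (𝓚' p F) y + gradient (𝓠' p F) y =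
              F y + ∑ j, 𝓑' p F j • D p j y) ∧
        (∀ (F G : EuclideanSpace ℝ (Fin 3) → EuclideanSpace ℝ (Fin 3)) (s : ℝ), (∃ R, YBound F R) → (∃ R, YBound G R) →
            (𝓚' p (fun y => F y + s • G y) = fun y => 𝓚' p F y + s • 𝓚' p G y) ∧
            (𝓑' p (fun y => F y + s • G y) = fun j => 𝓑' p F j + s * 𝓑' p G j)) := by
  -- the contraction factor of `T_p`
  have hθ : 4 * (C₂ * Γ ^ κ) * ν ≤ 1 / 2 := by linarith
  -- (T1) `T_p` contracts the Y-scale by `θ = 4 C₂ Γ^κ ν`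
  have hT1 : ∀ p : Fin N → ℝ, (∀ i, p i ∈ Icc (0:ℝ) 1) →
      ∀ (G : EuclideanSpace ℝ (Fin 3) → EuclideanSpace ℝ (Fin 3)) (R : ℝ), YBound G R →
        YBound (fun y => fderiv ℝ (𝓚 p G) y (V p y) + fderiv ℝ (V p) y (𝓚 p G y)) (4 * (C₂ * Γ ^ κ) * ν * R) := by
    intro p hp G R hG
    have hX : XBound (𝓚 p G) (C₂ * Γ ^ κ * R) := ((hgate p hp).1 G R hG).1
    have h1 := hX.yBound_fderiv_apply (hV p hp)
    have h2 := (hV p hp).yBound_fderiv_apply hX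
    exact (h1.add h2).mono (le_of_eq (by ring))
  -- (T2) `T_p` is linear on Y-bounded data
  have hT2 : ∀ p : Fin N → ℝ, (∀ i, p i ∈ Icc (0:ℝ) 1) →
      ∀ (G H : EuclideanSpace ℝ (Fin 3) → EuclideanSpace ℝ (Fin 3)) (s : ℝ), (∃ R, YBound G R) → (∃ R, YBound H R) →
        (fun y => fderiv ℝ (𝓚 p (fun y => G y + s • H y)) y (V p y) + fderiv ℝ (V p) y (𝓚 p (fun y => G y + s • H y) y)) =
          fun y => (fderiv ℝ (𝓚 p G) y (V p y) + fderiv ℝ (V p) y (𝓚 p G y)) +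
            s • (fderiv ℝ (𝓚 p H) y (V p y) + fderiv ℝ (V p) y (𝓚 p H y)) := by
    intro p hp G H s hG hH
    obtain ⟨R, hR⟩ := hG
    obtain ⟨R', hR'⟩ := hH
    have hlin := ((hgate p hp).2.1 G H s ⟨R, hR⟩ ⟨R', hR'⟩).1
    have hXG : XBound (𝓚 p G) (C₂ * Γ ^ κ * R) := ((hgate p hp).1 G R hR).1
    have hXH : XBound (𝓚 p H) (C₂ * Γ ^ κ * R') := ((hgate p hp).1 H R' hR').1
    funext y
    rw [hlin]
    have hdG : DifferentiableAt ℝ (𝓚 p G) y := hXG.1.differentiable (by norm_num) y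
    have hdH : DifferentiableAt ℝ (𝓚 p H) y := hXH.1.differentiable (by norm_num) y
    have hdsH : DifferentiableAt ℝ (fun y => s • 𝓚 p H y) y := hdH.fun_const_smul s
    show fderiv ℝ (fun y => 𝓚 p G y + s • 𝓚 p H y) y (V p y) + fderiv ℝ (V p) y (𝓚 p G y + s • 𝓚 p H y) =
      (fderiv ℝ (𝓚 p G) y (V p y) + fderiv ℝ (V p) y (𝓚 p G y)) +
        s • (fderiv ℝ (𝓚 p H) y (V p y) + fderiv ℝ (V p) y (𝓚 p H y))
    rw [fderiv_fun_add hdG hdsH, fderiv_fun_const_smul hdH]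
    have e3 : (fderiv ℝ (𝓚 p G) y + s • fderiv ℝ (𝓚 p H) y) (V p y) =
        fderiv ℝ (𝓚 p G) y (V p y) + s • fderiv ℝ (𝓚 p H) y (V p y) := rfl
    rw [e3, map_add, map_smul, smul_add]
    abel
  -- the Neumann solution operators `S_p`, chosen for every `p` of the cube
  have key : ∀ p : Fin N → ℝ, ∃ S : (EuclideanSpace ℝ (Fin 3) → EuclideanSpace ℝ (Fin 3)) →
      EuclideanSpace ℝ (Fin 3) → EuclideanSpace ℝ (Fin 3), (∀ i, p i ∈ Icc (0:ℝ) 1) →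
      (∀ (F : EuclideanSpace ℝ (Fin 3) → EuclideanSpace ℝ (Fin 3)) (R : ℝ), YBound F R → YBound (S F) (2 * R)) ∧
      (∀ (F : EuclideanSpace ℝ (Fin 3) → EuclideanSpace ℝ (Fin 3)) (R : ℝ), YBound F R →
        ∀ y, S F y = F y - (fderiv ℝ (𝓚 p (S F)) y (V p y) + fderiv ℝ (V p) y (𝓚 p (S F) y))) ∧
      (∀ (F H : EuclideanSpace ℝ (Fin 3) → EuclideanSpace ℝ (Fin 3)) (s : ℝ), (∃ R, YBound F R) → (∃ R, YBound H R) →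
        S (fun y => F y + s • H y) = fun y => S F y + s • S H y) := by
    intro p
    by_cases hp : ∀ i, p i ∈ Icc (0:ℝ) 1
    · choose S hS1 hS2 using fun F =>
        neumann_solution (T := fun G y => fderiv ℝ (𝓚 p G) y (V p y) + fderiv ℝ (V p) y (𝓚 p G y))
          (θ := 4 * (C₂ * Γ ^ κ) * ν) (hT1 p hp) (hT2 p hp) hθ F
      exact ⟨S, fun _ => ⟨hS1, hS2,
        neumann_linear (T := fun G y => fderiv ℝ (𝓚 p G) y (V p y) + fderiv ℝ (V p) y (𝓚 p G y))
          (θ := 4 * (C₂ * Γ ^ κ) * ν) (hT1 p hp) (hT2 p hp) hθ hS1 hS2⟩⟩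
    · exact ⟨fun F => F, fun h => absurd h hp⟩
  choose S hS using key
  refine ⟨fun p F => 𝓚 p (S p F), fun p F => 𝓠 p (S p F), fun p F => 𝓑 p (S p F), fun p hp => ⟨?_, ?_⟩⟩
  · -- clause (1) for the base `U⁰ + V`, constant `2 C₂`
    intro F R hF
    obtain ⟨hb, hf, -⟩ := hS p hp
    have hG : YBound (S p F) (2 * R) := hb F R hF
    obtain ⟨hX, hQ1, hQ, hB, hdiv, heq⟩ := (hgate p hp).1 (S p F) (2 * R) hG
    have e2 : C₂ * Γ ^ κ * (2 * R) = 2 * C₂ * Γ ^ κ * R := by ring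
    refine ⟨?_, hQ1, fun y => ?_, fun j => ?_, hdiv, fun y => ?_⟩
    · show XBound (𝓚 p (S p F)) (2 * C₂ * Γ ^ κ * R)
      exact hX.mono e2.le
    · show |𝓠 p (S p F) y| ≤ 2 * C₂ * Γ ^ κ * R
      exact (hQ y).trans e2.le
    · show |𝓑 p (S p F) j| ≤ 2 * C₂ * Γ ^ κ * R
      exact (hB j).trans e2.le
    · show lerayLin (α p) (fun z => U0 p z + V p z) (𝓚 p (S p F)) y + gradient (𝓠 p (S p F)) y =
        F y + ∑ j, 𝓑 p (S p F) j • D p j y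
      have hfix : S p F y = F y - (fderiv ℝ (𝓚 p (S p F)) y (V p y) + fderiv ℝ (V p) y (𝓚 p (S p F) y)) :=
        hf F R hF y
      rw [lerayLin_add_base (α p) (U0 p) (V p) (𝓚 p (S p F)) y (hU0 p hp y)
        ((hV p hp).1.differentiable (by norm_num) y)]
      have e1 : lerayLin (α p) (U0 p) (𝓚 p (S p F)) y +
            (fderiv ℝ (𝓚 p (S p F)) y (V p y) + fderiv ℝ (V p) y (𝓚 p (S p F) y)) + gradient (𝓠 p (S p F)) y =
          (lerayLin (α p) (U0 p) (𝓚 p (S p F)) y + gradient (𝓠 p (S p F)) y) +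
            (fderiv ℝ (𝓚 p (S p F)) y (V p y) + fderiv ℝ (V p) y (𝓚 p (S p F) y)) := by abel
      rw [e1, heq y, hfix]
      abel
  · -- clause (2): linearity on Y-bounded data
    intro F G s hF hG
    obtain ⟨hb, -, hl⟩ := hS p hp
    obtain ⟨R, hR⟩ := hF
    obtain ⟨R', hR'⟩ := hG
    have hlinS : S p (fun y => F y + s • G y) = fun y => S p F y + s • S p G y := hl F G s ⟨R, hR⟩ ⟨R', hR'⟩
    have h2 := (hgate p hp).2.1 (S p F) (S p G) s ⟨_, hb F R hR⟩ ⟨_, hb G R' hR'⟩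
    refine ⟨?_, ?_⟩
    · show 𝓚 p (S p (fun y => F y + s • G y)) = fun y => 𝓚 p (S p F) y + s • 𝓚 p (S p G) y
      rw [hlinS]
      exact h2.1
    · show 𝓑 p (S p (fun y => F y + s • G y)) = fun j => 𝓑 p (S p F) j + s * 𝓑 p (S p G) j
      rw [hlinS]
      exact h2.2

end Summit.NavierStokesRegularity.NavierStokesRegularity.Theorems.KelvinGate
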